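import Literature.NumberTheory.LFunctions.Zhang2022.KnifeEdgeLenLongLegSplit
import HarnessLib

/-!
# Negative lane, `LongPairsGradedTables` (stmt-Parity-20446): the DILATION STRUCTURE of the long ψ-datum and the exact
scaling of its sup / ℓ¹(dm/m) / ℓ²(dm/m) / ℓ²(dm/m²) functionals (kernel companion of the amplitude lemmas
`formulaILongPsi_iff_amp`, `formulaILongDual_iff_amp`, `lemma81LongPsi_iff_amp`)

Referee file (ls-ref-1 g8).  The `𝒳₂` long-pair cell feeds the len slots of
`Zhang2022/KnifeEdgeLenLongLegSplit.lean` with `𝐚₁ = longPsiData χ b g f` where the arithmetic factor is a DILATION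
`b = A·(δ_D ⋆ b₀)`, i.e. `b d = if D ∣ d then A * b₀ (d / D) else 0` with amplitude `A = D` (the cell's `D·(δ_D ⋆ υ·1_{≤D⁴})`
behind the prefactor `−χ(p)/τ(χ)`, `‖τ(χ)⁻¹‖ = D^{−1/2}`).  This file makes the dilation structure and the resulting norm
scalings kernel facts:

* `longPsiData_eq_zero_of_not_dvd` — if `b` lives on `Dℕ` then so does `longPsiData χ b g f`;
* `longPsiData_dilate_mul` — `longPsiData χ (A·δ_D⋆b₀) g f (D·n) = A · longPsiData χ b₀ g f n` (the datum IS the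
  `D`-dilation of the undilated datum, amplitude `A`);
* `sum_Ico_dilate` — reindexing `∑_{1 ≤ m < D·N, D ∣ m} G m = ∑_{1 ≤ m′ < N} G (D·m′)`;
* `l2half_dilate` / `l1_dilate` / `l2one_dilate` — for `c = A·(δ_D ⋆ a)`:
  `∑_{m<DN} ‖c m‖²/m = (‖A‖²/D)·∑_{m′<N} ‖a m′‖²/m′` (the (7.5)-type ℓ²(dm/m) mean square: `× D` at `A = D`, i.e. the
  NORM costs exactly `√D`), `∑ ‖c m‖/m = (‖A‖/D)·∑ ‖a m′‖/m′` (the ℓ¹(dm/m) functional of the main-term ε₁-sum: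
  INVARIANT at `A = D`), `∑ ‖c m‖²/m² = (‖A‖²/D²)·∑ ‖a m′‖²/m′²` (the σ = 1 sum of squares of (7.15): INVARIANT at
  `A = D` as a functional — its printed BOUND moves because the support moves to `𝔍/D`).
Together with the sup-norm scaling `× ‖A‖` (the `…_iff_amp` lemmas: slack `ε·A·𝔓`) this is the kernel form of the
cell's count «sup-accounting costs D, ℓ²(dm/m)-accounting costs √D, returned by ‖τ(χ)⁻¹‖ = D^{−1/2}»
(theory (D5″)(c)/(d), crit-1 16:31:23Z identity-level sharpening).  Helpers only: no `def`, no Theses statement asserted.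
[cite: Zhang2022LandauSiegel, §7 (7.2), (7.5) p.13, (7.15) p.14, (7.18)–(7.19) p.15; §8 Lemma 8.1 p.16]
-/

noncomputable section

open Complex Real Finset

namespace Summit.Parity.GeneralizedHardyLittlewood.Theorems.LongPairsGradedTables.Negative

open Literature.NumberTheory.LFunctions.Zhang2022.KnifeEdge.LongLegSplit

/-! ### Part 1 — the long ψ-datum inherits the dilation structure of `b` -/

/-- If the arithmetic factor `b` is supported on the multiples of `D`, then so is `longPsiData χ b g f`
(every term of the divisor sum carries a factor `b d` with `d ∣ n`). -/
theorem longPsiData_eq_zero_of_not_dvd {D : ℕ} (χ : DirichletCharacter ℂ D) {b : ℕ → ℂ} (g f : ℝ → ℂ)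
    (hb : ∀ d, ¬ D ∣ d → b d = 0) {n : ℕ} (hn : ¬ D ∣ n) : longPsiData χ b g f n = 0 := by
  unfold longPsiData
  refine Finset.sum_eq_zero fun p hp => ?_
  have hp1 : p.1 ∣ n := by
    rw [Nat.mem_divisorsAntidiagonal] at hp
    exact Dvd.intro _ hp.1
  have : ¬ D ∣ p.1 := fun h => hn (h.trans hp1)
  rw [hb _ this, zero_mul]

/-- The `D`-dilation with amplitude `A` of `b₀`, `d ↦ if D ∣ d then A·b₀(d/D) else 0`, vanishes off `Dℕ` (for `hb` above). -/
theorem dilate_eq_zero_of_not_dvd {D : ℕ} (A : ℂ) (b₀ : ℕ → ℂ) (d : ℕ) (hd : ¬ D ∣ d) :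
    (fun d => if D ∣ d then A * b₀ (d / D) else 0) d = 0 := by
  simp [hd]

/-- **The long ψ-datum is the `D`-dilation of the undilated datum, amplitude `A`:**
`longPsiData χ (A·δ_D⋆b₀) g f (D·n) = A · longPsiData χ b₀ g f n` (`0 < D`).  Proof: in the divisor sum over
`d·e = D·n` only `D ∣ d` survives, and `(d, e) ↦ (D·d, e)` is a bijection from the divisor pairs of `n`. -/
theorem longPsiData_dilate_mul {D : ℕ} (hD : 0 < D) (χ : DirichletCharacter ℂ D) (A : ℂ) (b₀ : ℕ → ℂ)
    (g f : ℝ → ℂ) (n : ℕ) :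
    longPsiData χ (fun d => if D ∣ d then A * b₀ (d / D) else 0) g f (D * n)
      = A * longPsiData χ b₀ g f n := by
  unfold longPsiData
  rw [← Finset.sum_filter_add_sum_filter_not (Nat.divisorsAntidiagonal (D * n)) (fun p : ℕ × ℕ => D ∣ p.1)]
  have hzero : ∑ p ∈ (Nat.divisorsAntidiagonal (D * n)).filter (fun p : ℕ × ℕ => ¬ D ∣ p.1),
      (if D ∣ p.1 then A * b₀ (p.1 / D) else 0) *
        ∑ q ∈ Nat.divisorsAntidiagonal p.2, profData χ g q.1 * profData χ f q.2 = 0 := by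
    refine Finset.sum_eq_zero fun p hp => ?_
    rw [Finset.mem_filter] at hp
    simp [hp.2]
  rw [hzero, add_zero]
  have himage : (Nat.divisorsAntidiagonal (D * n)).filter (fun p : ℕ × ℕ => D ∣ p.1)
      = (Nat.divisorsAntidiagonal n).image (fun p : ℕ × ℕ => (D * p.1, p.2)) := by
    ext ⟨x, y⟩
    simp only [Finset.mem_filter, Nat.mem_divisorsAntidiagonal, Finset.mem_image, Prod.mk.injEq, ne_eq]
    constructor
    · rintro ⟨⟨hxy, hne⟩, ⟨d, rfl⟩⟩
      refine ⟨(d, y), ⟨?_, ?_⟩, rfl, rfl⟩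
      · rw [mul_assoc] at hxy
        exact Nat.eq_of_mul_eq_mul_left hD hxy
      · rintro rfl
        exact hne (by simp)
    · rintro ⟨⟨d, e⟩, ⟨hde, hne⟩, hx, hy⟩
      simp only at hx hy
      subst hx; subst hy
      exact ⟨⟨by rw [mul_assoc, hde], Nat.mul_ne_zero hD.ne' hne⟩, ⟨d, rfl⟩⟩
  rw [himage, Finset.sum_image]
  · rw [Finset.mul_sum]
    refine Finset.sum_congr rfl fun p _ => ?_
    simp only [Nat.mul_div_cancel_left _ hD, dvd_mul_right, if_true]
    ring
  · rintro ⟨d, e⟩ _ ⟨d', e'⟩ _ h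
    simp only [Prod.mk.injEq] at h
    obtain ⟨h1, h2⟩ := h
    have : d = d' := Nat.eq_of_mul_eq_mul_left hD h1
    simp [this, h2]

/-- **Pointwise form:** `longPsiData χ (A·δ_D⋆b₀) g f m = if D ∣ m then A · longPsiData χ b₀ g f (m/D) else 0`
(`0 < D`) — the cell's long ψ-datum is, as a sequence, the amplitude-`A` `D`-dilation of the undilated datum. -/
theorem longPsiData_dilate_eq_ite {D : ℕ} (hD : 0 < D) (χ : DirichletCharacter ℂ D) (A : ℂ) (b₀ : ℕ → ℂ)
    (g f : ℝ → ℂ) (m : ℕ) :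
    longPsiData χ (fun d => if D ∣ d then A * b₀ (d / D) else 0) g f m
      = if D ∣ m then A * longPsiData χ b₀ g f (m / D) else 0 := by
  by_cases h : D ∣ m
  · obtain ⟨k, rfl⟩ := h
    rw [if_pos (dvd_mul_right D k), Nat.mul_div_cancel_left _ hD, longPsiData_dilate_mul hD]
  · rw [if_neg h]
    exact longPsiData_eq_zero_of_not_dvd χ g f (fun d hd => by simp [hd]) h

/-! ### Part 2 — reindexing a sum over the multiples of `D` -/

/-- **Reindexing:** `∑_{1 ≤ m < D·N} (if D ∣ m then G m else 0) = ∑_{1 ≤ m′ < N} G (D·m′)` (`0 < D`). -/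
theorem sum_Ico_dilate {M : Type*} [AddCommMonoid M] {D : ℕ} (hD : 0 < D) (N : ℕ) (G : ℕ → M) :
    ∑ m ∈ Ico 1 (D * N), (if D ∣ m then G m else 0) = ∑ m' ∈ Ico 1 N, G (D * m') := by
  rw [← Finset.sum_filter]
  have himage : (Ico 1 (D * N)).filter (fun m => D ∣ m) = (Ico 1 N).image (fun m' => D * m') := by
    ext m
    simp only [Finset.mem_filter, Finset.mem_Ico, Finset.mem_image]
    constructor
    · rintro ⟨⟨h1, h2⟩, ⟨k, rfl⟩⟩
      refine ⟨k, ⟨?_, ?_⟩, rfl⟩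
      · rcases Nat.eq_zero_or_pos k with hk | hk
        · subst hk; simp at h1
        · exact hk
      · exact Nat.lt_of_mul_lt_mul_left h2
    · rintro ⟨k, ⟨hk1, hk2⟩, rfl⟩
      exact ⟨⟨Nat.le_of_lt_succ (by nlinarith), Nat.mul_lt_mul_of_pos_left hk2 hD⟩, ⟨k, rfl⟩⟩
  rw [himage, Finset.sum_image]
  rintro a _ b _ h
  exact Nat.eq_of_mul_eq_mul_left hD h

/-! ### Part 3 — exact scaling of the weighted norms of a dilated sequence `c = A·(δ_D ⋆ a)` -/

/-- **ℓ²(dm/m) (the `σ = ½` large-sieve mean square of (7.5)):**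
`∑_{1 ≤ m < DN} ‖c m‖²/m = (‖A‖²/D) · ∑_{1 ≤ m′ < N} ‖a m′‖²/m′` for `c m = if D ∣ m then A·a(m/D) else 0`.
At `A = D` the mean square is `× D`: the ℓ²(dm/m) NORM of the cell datum costs exactly `√D`. -/
theorem l2half_dilate {D : ℕ} (hD : 0 < D) (N : ℕ) (A : ℂ) (a : ℕ → ℂ) :
    ∑ m ∈ Ico 1 (D * N), ‖(if D ∣ m then A * a (m / D) else 0)‖ ^ 2 / (m : ℝ)
      = ‖A‖ ^ 2 / D * ∑ m' ∈ Ico 1 N, ‖a m'‖ ^ 2 / (m' : ℝ) := by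
  have hD' : (D : ℝ) ≠ 0 := by exact_mod_cast hD.ne'
  have step : ∑ m ∈ Ico 1 (D * N), ‖(if D ∣ m then A * a (m / D) else 0)‖ ^ 2 / (m : ℝ)
      = ∑ m ∈ Ico 1 (D * N), (if D ∣ m then ‖A * a (m / D)‖ ^ 2 / (m : ℝ) else 0) := by
    refine Finset.sum_congr rfl fun m _ => ?_
    split_ifs <;> simp
  rw [step, sum_Ico_dilate hD, Finset.mul_sum]
  refine Finset.sum_congr rfl fun m _ => ?_
  rw [Nat.mul_div_cancel_left _ hD, norm_mul, mul_pow, Nat.cast_mul]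
  field_simp

/-- `A = D`: `∑_{m<DN} ‖c m‖²/m = D · ∑_{m′<N} ‖a m′‖²/m′`. -/
theorem l2half_dilate_amp_D {D : ℕ} (hD : 0 < D) (N : ℕ) (a : ℕ → ℂ) :
    ∑ m ∈ Ico 1 (D * N), ‖(if D ∣ m then (D : ℂ) * a (m / D) else 0)‖ ^ 2 / (m : ℝ)
      = D * ∑ m' ∈ Ico 1 N, ‖a m'‖ ^ 2 / (m' : ℝ) := by
  have hD' : (D : ℝ) ≠ 0 := by exact_mod_cast hD.ne'
  rw [l2half_dilate hD, Complex.norm_natCast]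
  congr 1
  field_simp

/-- **ℓ¹(dm/m) (the ε₁-sum of the main-term step (7.18)–(7.19)):**
`∑_{m<DN} ‖c m‖/m = (‖A‖/D) · ∑_{m′<N} ‖a m′‖/m′`; at `A = D` the functional is INVARIANT. -/
theorem l1_dilate {D : ℕ} (hD : 0 < D) (N : ℕ) (A : ℂ) (a : ℕ → ℂ) :
    ∑ m ∈ Ico 1 (D * N), ‖(if D ∣ m then A * a (m / D) else 0)‖ / (m : ℝ)
      = ‖A‖ / D * ∑ m' ∈ Ico 1 N, ‖a m'‖ / (m' : ℝ) := by
  have hD' : (D : ℝ) ≠ 0 := by exact_mod_cast hD.ne'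
  have step : ∑ m ∈ Ico 1 (D * N), ‖(if D ∣ m then A * a (m / D) else 0)‖ / (m : ℝ)
      = ∑ m ∈ Ico 1 (D * N), (if D ∣ m then ‖A * a (m / D)‖ / (m : ℝ) else 0) := by
    refine Finset.sum_congr rfl fun m _ => ?_
    split_ifs <;> simp
  rw [step, sum_Ico_dilate hD, Finset.mul_sum]
  refine Finset.sum_congr rfl fun m _ => ?_
  rw [Nat.mul_div_cancel_left _ hD, norm_mul, Nat.cast_mul]
  field_simp

/-- `A = D`: `∑_{m<DN} ‖c m‖/m = ∑_{m′<N} ‖a m′‖/m′` (dilation-invariance of the ℓ¹(dm/m) functional). -/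
theorem l1_dilate_amp_D {D : ℕ} (hD : 0 < D) (N : ℕ) (a : ℕ → ℂ) :
    ∑ m ∈ Ico 1 (D * N), ‖(if D ∣ m then (D : ℂ) * a (m / D) else 0)‖ / (m : ℝ)
      = ∑ m' ∈ Ico 1 N, ‖a m'‖ / (m' : ℝ) := by
  have hD' : (D : ℝ) ≠ 0 := by exact_mod_cast hD.ne'
  rw [l1_dilate hD, Complex.norm_natCast, div_self hD', one_mul]

/-- **ℓ²(dm/m²) (the `σ = 1` sum of squares of (7.15)):**
`∑_{m<DN} ‖c m‖²/m² = (‖A‖²/D²) · ∑_{m′<N} ‖a m′‖²/m′²`; at `A = D` the functional is INVARIANT (its printed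
BOUND `τ₅²𝓛^c·∑_{l∈𝔍} l⁻²` is not: the support moves to `𝔍/D`, where `∑ l⁻²` is `D` times larger). -/
theorem l2one_dilate {D : ℕ} (hD : 0 < D) (N : ℕ) (A : ℂ) (a : ℕ → ℂ) :
    ∑ m ∈ Ico 1 (D * N), ‖(if D ∣ m then A * a (m / D) else 0)‖ ^ 2 / (m : ℝ) ^ 2
      = ‖A‖ ^ 2 / (D : ℝ) ^ 2 * ∑ m' ∈ Ico 1 N, ‖a m'‖ ^ 2 / (m' : ℝ) ^ 2 := by
  have hD' : (D : ℝ) ≠ 0 := by exact_mod_cast hD.ne'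
  have step : ∑ m ∈ Ico 1 (D * N), ‖(if D ∣ m then A * a (m / D) else 0)‖ ^ 2 / (m : ℝ) ^ 2
      = ∑ m ∈ Ico 1 (D * N), (if D ∣ m then ‖A * a (m / D)‖ ^ 2 / (m : ℝ) ^ 2 else 0) := by
    refine Finset.sum_congr rfl fun m _ => ?_
    split_ifs <;> simp
  rw [step, sum_Ico_dilate hD, Finset.mul_sum]
  refine Finset.sum_congr rfl fun m _ => ?_
  rw [Nat.mul_div_cancel_left _ hD, norm_mul, mul_pow, Nat.cast_mul, mul_pow]
  field_simp

/-- `A = D`: `∑_{m<DN} ‖c m‖²/m² = ∑_{m′<N} ‖a m′‖²/m′²` (dilation-invariance of the σ = 1 sum of squares). -/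
theorem l2one_dilate_amp_D {D : ℕ} (hD : 0 < D) (N : ℕ) (a : ℕ → ℂ) :
    ∑ m ∈ Ico 1 (D * N), ‖(if D ∣ m then (D : ℂ) * a (m / D) else 0)‖ ^ 2 / (m : ℝ) ^ 2
      = ∑ m' ∈ Ico 1 N, ‖a m'‖ ^ 2 / (m' : ℝ) ^ 2 := by
  have hD' : (D : ℝ) ≠ 0 := by exact_mod_cast hD.ne'
  rw [l2one_dilate hD, Complex.norm_natCast, div_self (pow_ne_zero 2 hD'), one_mul]

/-- **sup norm (the (7.2) class, the `…_iff_amp` currency):** `‖c m‖ ≤ ‖A‖ · sup ‖a‖` — the only one of the four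
functionals that costs the full amplitude. -/
theorem sup_dilate {D : ℕ} (A : ℂ) (a : ℕ → ℂ) {B : ℝ} (ha : ∀ n, ‖a n‖ ≤ B) (m : ℕ) :
    ‖(if D ∣ m then A * a (m / D) else 0)‖ ≤ ‖A‖ * B := by
  have hB : 0 ≤ B := le_trans (norm_nonneg _) (ha 0)
  split_ifs
  · rw [norm_mul]; exact mul_le_mul_of_nonneg_left (ha _) (norm_nonneg _)
  · simpa using mul_nonneg (norm_nonneg A) hB

/-! ### Part 4 — the cell datum: its (7.5)-type mean square is exactly `D ×` the undilated one -/

/-- **HEADLINE (kernel form of the ℓ² count at (7.5)):** for the long ψ-datum built on the dilated arithmetic factor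
`b = D·(δ_D ⋆ b₀)`, `∑_{1 ≤ m < D·N} ‖𝐚₁(m)‖²/m = D · ∑_{1 ≤ m′ < N} ‖𝐚₁⁰(m′)‖²/m′` with `𝐚₁⁰ = longPsiData χ b₀ g f`
— the ℓ²(dm/m) norm of the cell datum is EXACTLY `√D` times the undilated one (against `× D` for the sup norm), so
after the prefactor `‖τ(χ)⁻¹‖ = D^{−1/2}` the ℓ²-accounted slack is amplitude-neutral while the sup-accounted slack of
the typed slots (`…_iff_amp`) keeps `√D`. -/
theorem l2half_longPsiData_dilate_amp_D {D : ℕ} (hD : 0 < D) (χ : DirichletCharacter ℂ D) (b₀ : ℕ → ℂ)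
    (g f : ℝ → ℂ) (N : ℕ) :
    ∑ m ∈ Ico 1 (D * N), ‖longPsiData χ (fun d => if D ∣ d then (D : ℂ) * b₀ (d / D) else 0) g f m‖ ^ 2 / (m : ℝ)
      = D * ∑ m' ∈ Ico 1 N, ‖longPsiData χ b₀ g f m'‖ ^ 2 / (m' : ℝ) := by
  have step : ∑ m ∈ Ico 1 (D * N),
      ‖longPsiData χ (fun d => if D ∣ d then (D : ℂ) * b₀ (d / D) else 0) g f m‖ ^ 2 / (m : ℝ)
      = ∑ m ∈ Ico 1 (D * N),
          ‖(if D ∣ m then (D : ℂ) * longPsiData χ b₀ g f (m / D) else 0)‖ ^ 2 / (m : ℝ) := by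
    refine Finset.sum_congr rfl fun m _ => ?_
    rw [longPsiData_dilate_eq_ite hD]
  rw [step, l2half_dilate_amp_D hD]

/-- **ℓ¹(dm/m) companion for the cell datum:** `∑_{m<DN} ‖𝐚₁(m)‖/m = ∑_{m′<N} ‖𝐚₁⁰(m′)‖/m′` — the main-term
ε₁-functional of (7.18)–(7.19) does not see the dilation at all. -/
theorem l1_longPsiData_dilate_amp_D {D : ℕ} (hD : 0 < D) (χ : DirichletCharacter ℂ D) (b₀ : ℕ → ℂ)
    (g f : ℝ → ℂ) (N : ℕ) :
    ∑ m ∈ Ico 1 (D * N), ‖longPsiData χ (fun d => if D ∣ d then (D : ℂ) * b₀ (d / D) else 0) g f m‖ / (m : ℝ)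
      = ∑ m' ∈ Ico 1 N, ‖longPsiData χ b₀ g f m'‖ / (m' : ℝ) := by
  have step : ∑ m ∈ Ico 1 (D * N),
      ‖longPsiData χ (fun d => if D ∣ d then (D : ℂ) * b₀ (d / D) else 0) g f m‖ / (m : ℝ)
      = ∑ m ∈ Ico 1 (D * N),
          ‖(if D ∣ m then (D : ℂ) * longPsiData χ b₀ g f (m / D) else 0)‖ / (m : ℝ) := by
    refine Finset.sum_congr rfl fun m _ => ?_
    rw [longPsiData_dilate_eq_ite hD]
  rw [step, l1_dilate_amp_D hD]

end Summit.Parity.GeneralizedHardyLittlewood.Theorems.LongPairsGradedTables.Negative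

end
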